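import Literature.NumberTheory.Automorphic.QuaternionIdealLocallyPrincipal
import Literature.NumberTheory.Automorphic.QuaternionMaximalOrder
import Literature.NumberTheory.Automorphic.EichlerOrderLocalGlobal
import HarnessLib

/-!
# A maximal `ℤ`-order is locally maximal: subrings of `B` squeezed between `O₁,₍ₚ₎` and a
# bounded denominator are `O₁,₍ₚ₎`; the trace-dual bound

Topic `NumberTheory/Automorphic`; theorems only (no definition, no named fact, no instance).
Common backbone of the local study of the maximal orders of a definite quaternion algebra `B`
over `ℚ` at a prime `p` (Vignéras, *Arithmétique des algèbres de quaternions*, LNM 800,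
Ch. II §1 (ramified: the unique maximal order is the valuation ring `{n(h) ∈ R}`, Lemme 1.5)
and §2 (split: the maximal orders are the `End(L)`, Lemme 2.1, Thm. 2.3), made global by
Ch. III §5 Prop. 5.1 "être un ordre maximal est une propriété locale"), in the elementary
language of the localisations `localAt p L ⊆ B` of `LatticeLocalGlobal.lean`:

* `localizedAt_eq_localAt` — the two localisations of the tree agree at a prime
  (`EichlerOrderLocalGlobal.localizedAt`, defined through `IsCoprime (p : ℤ) s`, and `localAt`,
  defined through `Nat.Coprime m p`).
* `IsMaximalZOrder.coe_eq_localAt_of_subring` — **patching** (Vignéras III §5 Prop. 5.1,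
  propriété locale (2)): if `O₁` is a maximal `ℤ`-order, `S ⊆ B` a subring containing `O₁,₍ₚ₎`
  and `d • S ⊆ O₁,₍ₚ₎` for some integer `d ≠ 0`, then `S = O₁,₍ₚ₎`. (The lattice
  `{x ∈ S | x ∈ O₁,₍q₎ for all primes q ≠ p}` is a `ℤ`-order containing `O₁`.)
* `IsZOrder.exists_smul_mem_localAt_of_reducedTrace` — **the trace-dual bound**: for a
  `ℤ`-order `O` of a division quaternion algebra there is `d ≠ 0` such that every `x ∈ B` with
  `trd(x y) ∈ ℤ₍ₚ₎` for all `y ∈ O` satisfies `d x ∈ O₍ₚ₎` (the trace form is nondegenerate and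
  the dual lattice `O♯` is finitely generated, `QuaternionMaximalOrder.lean`; Vignéras I §4
  Lemme 4.7).

Together: a subring `S ⊇ O₁,₍ₚ₎` all of whose elements pair `p`-integrally with `O₁` under the
reduced trace *is* `O₁,₍ₚ₎` (`IsMaximalZOrder.coe_eq_localAt_of_reducedTrace`) — the form in
which both local models (`{v_p(nrd) ≥ 0}` at a ramified prime, `Φ⁻¹(M₂(ℤ_p))` at a split prime)
are identified with the localisation of a *given* global maximal order in the proof of the
Eichler mass formula (`brandtModule_massFormula`).

## References

* M.-F. Vignéras, *Arithmétique des algèbres de quaternions*, LNM 800 (1980), Ch. I §4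
  Lemme 4.7, Ch. II §§1–2, Ch. III §5 Prop. 5.1 [VignerasLNM800].
* J. Voight, *Quaternion Algebras*, GTM 288 (2021), Lemma 10.4.2–10.4.3, §15.6.
-/

noncomputable section

open scoped Pointwise

universe u

namespace Literature.NumberTheory.Automorphic

/-! ### The two localisations of the tree agree -/

section Bridge

variable {B : Type*} [Ring B]

/-- `localizedAt p L = localAt p L` for `p > 1` (in particular for `p` prime):
`IsCoprime (p : ℤ) s ↔ Nat.Coprime s.natAbs p`, and `s • x ∈ L ↔ |s| • x ∈ L`. [folklore] -/
theorem localizedAt_eq_localAt {p : ℕ} (hp : 1 < p) (L : Submodule ℤ B) :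
    localizedAt p L = localAt p L := by
  ext x
  rw [mem_localizedAt_iff, mem_localAt_iff]
  constructor
  · rintro ⟨s, hs, hsx⟩
    have hs0 : s ≠ 0 := by
      rintro rfl
      rw [isCoprime_zero_right, Int.isUnit_iff_natAbs_eq, Int.natAbs_natCast] at hs
      omega
    refine ⟨s.natAbs, Int.natAbs_ne_zero.mpr hs0, ?_, ?_⟩
    · have h := Int.isCoprime_iff_gcd_eq_one.mp hs
      rw [Int.gcd_eq_natAbs, Int.natAbs_natCast] at h
      exact Nat.Coprime.symm h
    · rcases Int.natAbs_eq s with h | h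
      · rw [← h]; exact hsx
      · rw [show ((s.natAbs : ℕ) : ℤ) = -s by omega, neg_smul]
        exact L.neg_mem hsx
  · rintro ⟨m, hm0, hm, hmx⟩
    refine ⟨m, ?_, hmx⟩
    rw [Int.isCoprime_iff_gcd_eq_one, Int.gcd_natCast_natCast]
    exact Nat.Coprime.symm hm

end Bridge

/-! ### Patching: a maximal order is locally maximal -/

section Patching

variable {B : Type u} [Ring B] [Algebra ℚ B]

/-- **A maximal `ℤ`-order is locally maximal, subring form** (Vignéras III §5 Prop. 5.1,
propriété locale (2)). Let `O₁` be a maximal `ℤ`-order of a `ℚ`-algebra `B`, `p` a prime and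
`S ⊆ B` a subring with `O₁,₍ₚ₎ ⊆ S` and `d • S ⊆ O₁,₍ₚ₎` for some integer `d ≠ 0`. Then
`S = O₁,₍ₚ₎`. Proof: `O' = {x ∈ S | x ∈ O₁,₍q₎ for every prime q ≠ p}` is a subring containing
`O₁`, finitely generated because `d • O' ⊆ O₁` (local–global principle), hence a `ℤ`-order,
so `O' = O₁` by maximality; and every `x ∈ S` has a prime-to-`p` multiple in `O'`. [cite: VignerasLNM800, Ch. III §5 Prop. 5.1 and propriété locale (2)] -/
theorem IsMaximalZOrder.coe_eq_localAt_of_subring {O₁ : Submodule ℤ B} (hO₁ : IsMaximalZOrder O₁)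
    {p : ℕ} (hp : p.Prime) (S : Subring B) (hle : (localAt p O₁ : Set B) ⊆ S) {d : ℤ} (hd : d ≠ 0)
    (hbd : ∀ x ∈ S, d • x ∈ localAt p O₁) : (S : Set B) = localAt p O₁ := by
  haveI : Fact p.Prime := ⟨hp⟩
  -- the patched lattice
  let O' : Submodule ℤ B :=
    { carrier := {x | x ∈ S ∧ ∀ q : ℕ, q.Prime → q ≠ p → x ∈ localAt q O₁}
      add_mem' := fun {a b} ha hb =>
        ⟨S.add_mem ha.1 hb.1, fun q hq hqp => Submodule.add_mem _ (ha.2 q hq hqp) (hb.2 q hq hqp)⟩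
      zero_mem' := ⟨S.zero_mem, fun q _ _ => Submodule.zero_mem _⟩
      smul_mem' := fun n x hx =>
        ⟨zsmul_mem hx.1 n, fun q hq hqp => Submodule.smul_mem _ n (hx.2 q hq hqp)⟩ }
  have hmemO' : ∀ x : B, x ∈ O' ↔ x ∈ S ∧ ∀ q : ℕ, q.Prime → q ≠ p → x ∈ localAt q O₁ :=
    fun x => Iff.rfl
  have hO₁le : O₁ ≤ O' := fun x hx =>
    ⟨hle (le_localAt p O₁ hx), fun q _ _ => le_localAt q O₁ hx⟩
  -- `d • O' ⊆ O₁`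
  have hdO' : ∀ y ∈ O', d • y ∈ O₁ := by
    intro y hy
    refine mem_of_forall_prime_mem_localAt fun q hq => ?_
    by_cases hqp : q = p
    · subst hqp; exact hbd y hy.1
    · exact Submodule.smul_mem _ d (hy.2 q hq hqp)
  have hO' : IsZOrder O' :=
    { one_mem := hO₁le hO₁.1.one_mem
      mul_mem := fun a ha b hb =>
        ⟨S.mul_mem ha.1 hb.1, fun q hq hqp =>
          mul_mem_localAt hO₁.1.mul_mem q (ha.2 q hq hqp) (hb.2 q hq hqp)⟩
      isFullLattice := by
        refine ⟨fg_of_smul_mem hO₁.1.isFullLattice.1 hd hdO', fun x => ?_⟩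
        obtain ⟨n, hn, hnx⟩ := hO₁.1.isFullLattice.2 x
        exact ⟨n, hn, hO₁le hnx⟩ }
  have hO'eq : O' = O₁ := hO₁.2 O' hO' hO₁le
  -- conclusion
  refine Set.Subset.antisymm (fun x hx => ?_) hle
  obtain ⟨m, hm0, hm, hmdx⟩ := hbd x hx
  -- `d = ± p^v d'` with `d'` prime to `p`
  set d' : ℕ := d.natAbs / p ^ (d.natAbs).factorization p with hd'
  have hdabs : d.natAbs ≠ 0 := Int.natAbs_ne_zero.mpr hd
  have hd'cop : d'.Coprime p := (Nat.coprime_ordCompl hp hdabs).symm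
  have hd'0 : d' ≠ 0 := (Nat.div_pos (Nat.ordProj_le p hdabs) (Nat.ordProj_pos _ p)).ne'
  have hdecomp : (p ^ (d.natAbs).factorization p * d' : ℕ) = d.natAbs :=
    Nat.ordProj_mul_ordCompl_eq_self _ p
  -- `y = (m d') • x ∈ O'`
  have hyS : ((m * d' : ℕ) : ℤ) • x ∈ S := zsmul_mem hx _
  have hpow : ((p : ℤ) ^ (d.natAbs).factorization p) • (((m * d' : ℕ) : ℤ) • x) ∈ O₁ := by
    have hmd : ((m : ℤ) * d) • x ∈ O₁ := by
      rw [mul_smul]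
      -- `m • (d • x) ∈ O₁` from `d • x ∈ O₁,₍p₎` with the witness `m`? we only know some witness;
      -- use the chosen one
      exact hmdx
    have key : ((p : ℤ) ^ (d.natAbs).factorization p) * ((m * d' : ℕ) : ℤ) = m * d ∨
        ((p : ℤ) ^ (d.natAbs).factorization p) * ((m * d' : ℕ) : ℤ) = -(m * d) := by
      rcases Int.natAbs_eq d with h | h
      · left
        conv_rhs => rw [h, ← hdecomp]
        push_cast; ring
      · right
        conv_rhs => rw [h, ← hdecomp]
        push_cast; ring
    rw [smul_smul]
    rcases key with h | h
    · rw [h]; exact hmd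
    · rw [h, neg_smul]; exact O₁.neg_mem hmd
  have hyO' : ((m * d' : ℕ) : ℤ) • x ∈ O' := by
    refine ⟨hyS, fun q hq hqp => ?_⟩
    haveI : Fact q.Prime := ⟨hq⟩
    have hcop : (p ^ (d.natAbs).factorization p).Coprime q :=
      Nat.Coprime.pow_left _ ((Nat.coprime_primes hp hq).mpr (Ne.symm hqp))
    refine mem_localAt_of_smul_mem (pow_ne_zero _ hp.ne_zero) hcop ?_
    push_cast
    exact hpow
  rw [hO'eq] at hyO'
  exact mem_localAt_of_smul_mem (mul_ne_zero hm0 hd'0) (hm.mul_left hd'cop) hyO'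

end Patching

/-! ### The trace-dual bound -/

section DualBound

variable {B : Type u} [Ring B] [Algebra ℚ B] [IsQuaternionAlgebra ℚ B]

/-- A rational number times a multiple of its denominator is an integer. [folklore] -/
theorem Rat.exists_int_natCast_mul_of_den_dvd (q : ℚ) {m : ℕ} (h : q.den ∣ m) :
    ∃ z : ℤ, (z : ℚ) = (m : ℚ) * q := by
  obtain ⟨k, hk⟩ := h
  refine ⟨k * q.num, ?_⟩
  have hq : q * q.den = q.num := Rat.mul_den_eq_num q
  rw [hk]
  push_cast
  rw [← hq]
  ring

/-- **The trace-dual bound.** For a `ℤ`-order `O` of a division quaternion algebra `B` over `ℚ`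
and a prime `p` there is an integer `d ≠ 0` such that every `x ∈ B` whose reduced traces
`trd(x y)`, `y ∈ O`, are `p`-integral satisfies `d x ∈ O₍ₚ₎`: clearing the prime-to-`p`
denominators of `trd(x yᵢ)` over generators `yᵢ` of `O` puts a prime-to-`p` multiple of `x`
into the trace dual `O♯`, a finitely generated lattice (the trace form is nondegenerate), and
`d O♯ ⊆ O`. [cite: VignerasLNM800, Ch. I §4 Lemme 4.7] -/
theorem IsZOrder.exists_smul_mem_localAt_of_reducedTrace (hdiv : ∀ x : B, x ≠ 0 → IsUnit x)
    {O : Submodule ℤ B} (hO : IsZOrder O) (p : ℕ) [Fact p.Prime] :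
    ∃ d : ℤ, d ≠ 0 ∧ ∀ x : B, (∀ y ∈ O, ¬ p ∣ (reducedTrace ℚ B (x * y)).den) →
      d • x ∈ localAt p O := by
  classical
  have hp : p.Prime := Fact.out
  set T := (LinearMap.mul ℚ B).compr₂ (reducedTrace ℚ B) with hT
  have hTnd := nondegenerate_mul_compr₂_reducedTrace (D := B) hdiv
  set Od := LinearMap.BilinForm.dualSubmodule T O with hOd
  have hfg : Od.FG := fg_dualSubmodule_of_isFullLattice hTnd hO.isFullLattice
  obtain ⟨s, hs⟩ := hfg
  -- `d • Od ⊆ O`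
  have hgen : ∀ g : B, ∃ n : ℤ, n ≠ 0 ∧ n • g ∈ O := fun g => hO.isFullLattice.2 g
  choose n hn0 hn using hgen
  set d : ℤ := ∏ g ∈ s, n g with hd
  have hd0 : d ≠ 0 := Finset.prod_ne_zero_iff.mpr fun g _ => hn0 g
  have hdOd : ∀ z ∈ Od, d • z ∈ O := by
    intro z hz
    rw [← hs] at hz
    induction hz using Submodule.span_induction with
    | mem g hg =>
      rw [hd, ← Finset.mul_prod_erase s n hg, mul_comm, mul_smul]
      exact O.smul_mem _ (hn g)
    | zero => rw [smul_zero]; exact O.zero_mem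
    | add a b _ _ ha hb => rw [smul_add]; exact O.add_mem ha hb
    | smul k a _ ha => rw [smul_comm]; exact O.smul_mem k ha
  refine ⟨d, hd0, fun x hx => ?_⟩
  -- clear the prime-to-`p` denominators over generators of `O`
  obtain ⟨t, ht⟩ := hO.isFullLattice.1
  set m : ℕ := ∏ y ∈ t, (reducedTrace ℚ B (x * y)).den with hm
  have hm0 : m ≠ 0 := Finset.prod_ne_zero_iff.mpr fun y _ => Rat.den_ne_zero _
  have hmcop : m.Coprime p := by
    refine Nat.Coprime.prod_left fun y hy => ?_
    exact (Nat.Prime.coprime_iff_not_dvd hp).mpr (hx y (ht ▸ Submodule.subset_span hy)) |>.symm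
  have hmx : ((m : ℤ)) • x ∈ Od := by
    rw [hOd, LinearMap.BilinForm.mem_dualSubmodule]
    intro y hy
    rw [← ht] at hy
    induction hy using Submodule.span_induction with
    | mem y hy =>
      rw [hT, mul_compr₂_reducedTrace_apply, smul_mul_assoc, map_zsmul, zsmul_eq_mul,
        Int.cast_natCast, Submodule.mem_one]
      obtain ⟨z, hz⟩ := Rat.exists_int_natCast_mul_of_den_dvd (reducedTrace ℚ B (x * y))
        (Finset.dvd_prod_of_mem (fun y => (reducedTrace ℚ B (x * y)).den) hy)
      exact ⟨z, by rw [eq_intCast, hz]⟩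
    | zero => rw [LinearMap.map_zero]; exact Submodule.zero_mem _
    | add a b _ _ ha hb => rw [LinearMap.map_add]; exact Submodule.add_mem _ ha hb
    | smul k a _ ha =>
      rw [LinearMap.map_smul_of_tower]
      exact Submodule.smul_mem _ k ha
  have hdm : (m : ℤ) • (d • x) ∈ O := by
    rw [smul_comm]
    exact hdOd _ hmx
  exact mem_localAt_of_smul_mem hm0 hmcop hdm

/-- **A maximal order is locally maximal, trace form.** If `O₁` is a maximal `ℤ`-order of a
division quaternion algebra `B` over `ℚ`, `p` a prime and `S ⊆ B` a subring containing `O₁,₍ₚ₎`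
such that `trd(x y) ∈ ℤ₍ₚ₎` for all `x ∈ S`, `y ∈ O₁`, then `S = O₁,₍ₚ₎`
(`coe_eq_localAt_of_subring` with the trace-dual bound). [cite: VignerasLNM800, Ch. III §5 Prop. 5.1, Ch. I §4 Lemme 4.7] -/
theorem IsMaximalZOrder.coe_eq_localAt_of_reducedTrace (hdiv : ∀ x : B, x ≠ 0 → IsUnit x)
    {O₁ : Submodule ℤ B} (hO₁ : IsMaximalZOrder O₁) {p : ℕ} (hp : p.Prime) (S : Subring B)
    (hle : (localAt p O₁ : Set B) ⊆ S)
    (htr : ∀ x ∈ S, ∀ y ∈ O₁, ¬ p ∣ (reducedTrace ℚ B (x * y)).den) :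
    (S : Set B) = localAt p O₁ := by
  haveI : Fact p.Prime := ⟨hp⟩
  obtain ⟨d, hd0, hd⟩ := hO₁.1.exists_smul_mem_localAt_of_reducedTrace hdiv p
  exact hO₁.coe_eq_localAt_of_subring hp S hle hd0 fun x hx => hd x (htr x hx)

end DualBound

end Literature.NumberTheory.Automorphic
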